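/-
Copyright (c) 2026. All rights reserved.
Released under Apache 2.0 license as described in the file LICENSE.
-/
import Literature.NumberTheory.Automorphic.MaximalOrderDiscThirteenLattice
import HarnessLib

/-!
# The ramified prime `13` of the maximal order `O₁₃` of `(−2,−13 ∣ ℚ)`: left multiplication by `j` (`nrd j = 13`) is the explicit
# bijection `(A,B,C,D) ↦ (−A−2B−8C, −A+B+4D, 2A+C−D, −4B−2C−D)` from `{Q₁₃ = n}` onto `{Q₁₃ = 13n}` for the norm form
# `Q₁₃ = a² + 2b² + 4c² + 2d² + ac − ad + 2bc + bd`; hence `r₁₃(13n) = r₁₃(n)`, `r₁₃(13ᵃ) = 2`, `#{x ∈ O₁₃ : nrd x = 13n} = #{x ∈ O₁₃ : nrd x = n}`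

[tag: quaternion_algebra] [tag: quadratic_form] [tag: ramification]

Topic `NumberTheory/Automorphic`; THEOREMS ONLY (no definition, no named fact, no instance; net Literature debt `0`).
Lane `lit-hodgefound`, seat p12, gen 46 — fifth file on the definite quaternion order of discriminant `13` (after
`MaximalOrderDiscThirteen{Lattice, Ramification, DedekindHasse, ClassNumberOne}`), the `D = 13` counterpart of
`MaximalOrderDiscFiveNormsFiveMul` ∕ `MaximalOrderDiscSevenNormsSevenMul`. At the ramified prime `13` the maximal order
`O₁₃ = ℤ⟨1, i, α, η⟩` has the two-sided ideal `jO₁₃` (`j = 2α − 1 − i`, `nrd j = 13`, `jij⁻¹ = −i`, `jαj⁻¹ = α − i`, `jηj⁻¹ = −1 − η`,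
`O₁₃/jO₁₃ ≅ 𝔽₁₆₉`), so `13 ∣ nrd x ⟺ x ∈ jO₁₃` and `x ↦ jx` is a bijection `{nrd = n} → {nrd = 13n}` (Eichler LNM 320 II §2:
`ζ_p(s) = (1 − p^{−2s})⁻¹` for `p ∣ D`; §6 Thm. 2 (20)). In the coordinates `x = a + bi + cα + dη`
(`MaximalOrderDiscThirteenLattice.reducedNorm_mk`) everything is explicit on `ℤ⁴` and needs no class number:

* §1 `basisJ_mul_mk` (**`j·(A + Bi + Cα + Dη) = (−A−2B−8C) + (−A+B+4D)i + (2A+C−D)α + (−4B−2C−D)η`**), `reducedNorm_basisJ` (`= 13`),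
  `form_thirteenMap` (`Q₁₃(φv) = 13Q₁₃(v)`), **`thirteen_dvd_form_iff`** (**`13 ∣ Q₁₃(a,b,c,d) ⟺ 2a + c − d ≡ 0 ∧ 4b + 2c + d ≡ 0 (mod 13)`**
  — `16Q₁₃ = 4(2a+c−d)² + 2(4b+2c+d)² + 52c² + 26d²` and `−2` is a non-residue mod `13`), **`natCard_form_thirteen_mul`**
  (`#{Q₁₃ = 13n} = #{Q₁₃ = n}`), `natCard_form_thirteen_pow_mul`, **`natCard_form_thirteen_pow`** (`r₁₃(13ᵃ) = 2`);
* §2 for `O₁₃`: **`natCard_reducedNorm_thirteen_mul`** (`#{x ∈ O₁₃ : nrd x = 13n} = #{x ∈ O₁₃ : nrd x = n}`),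
  `natCard_reducedNorm_thirteen_pow` (`= 2`), `exists_mem_eq_basisJ_mul_of_thirteen_dvd` (`x ∈ O₁₃`, `13 ∣ nrd x ⟹ x = jy`, `y ∈ O₁₃`).

## Sources

* M. Eichler, LNM 320 (1973), Ch. II §2 (`ζ_p(s) = (1 − p^{−2s})⁻¹`, `p ∣ D`: one integral ideal of each norm `pᵃ`) and §6 Thm. 2
  (20). [cite: Eichler1973, Ch. II §2 and §6 Thm. 2 (20)]
* M.-F. Vignéras, LNM 800 (1980), Ch. II §1 Lemme 1.5, Cor. 1.7 (the unique maximal ideal `P = Ou = uO` above a ramified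
  prime). [cite: VignerasLNM800, Ch. II §1 Lemme 1.5 and Cor. 1.7]
* J. Voight, *Quaternion Algebras*, GTM 288 (2021), Exercise 17.10, Thm. 25.4.1 (`D = 13`), §13.3. [cite: Voight2021, Exercise 17.10; §13.3]

## Scope (honest)

Theorems only — no definition, no named fact, no instance. This file is the part of the `D = 13` story that is independent of the
class number; the Brandt matrices `T(13ᵃ) = 1` follow in the Brandt-setup sequel.
-/

open Quaternion
open scoped Pointwise

namespace Literature.NumberTheory.Automorphic.MaxOrderDiscThirteen

/-! ## §1 The `13`-map on `ℤ⁴` -/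

section Form

/-- **Left multiplication by `j` in the coordinates of `O₁₃`: `j·(A + Bi + Cα + Dη) = (−A−2B−8C) + (−A+B+4D)i + (2A+C−D)α + (−4B−2C−D)η`.**
[cite: VignerasLNM800, Ch. II §1 Lemme 1.5] -/
theorem basisJ_mul_mk (A B C D : ℤ) :
    (⟨0, 0, 1, 0⟩ : ℍ[ℚ,-2,-13]) * ⟨(A : ℚ) + (C : ℚ) / 2 - (D : ℚ) / 2, (B : ℚ) + (C : ℚ) / 2 + (D : ℚ) / 4, (C : ℚ) / 2, (D : ℚ) / 4⟩ =
      ⟨((-A - 2 * B - 8 * C : ℤ) : ℚ) + ((2 * A + C - D : ℤ) : ℚ) / 2 - ((-4 * B - 2 * C - D : ℤ) : ℚ) / 2,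
        ((-A + B + 4 * D : ℤ) : ℚ) + ((2 * A + C - D : ℤ) : ℚ) / 2 + ((-4 * B - 2 * C - D : ℤ) : ℚ) / 4,
        ((2 * A + C - D : ℤ) : ℚ) / 2, ((-4 * B - 2 * C - D : ℤ) : ℚ) / 4⟩ := by
  ext <;> simp [QuaternionAlgebra.mk_mul_mk] <;> ring

/-- **`nrd j = 13`**: `j` is a uniformiser at the ramified prime. [cite: VignerasLNM800, Ch. II §1 Lemme 1.5] -/
theorem reducedNorm_basisJ : reducedNorm ℚ ℍ[ℚ,-2,-13] (⟨0, 0, 1, 0⟩ : ℍ[ℚ,-2,-13]) = 13 := by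
  rw [reducedNorm_eq]
  norm_num

/-- `Q₁₃(−A−2B−8C, −A+B+4D, 2A+C−D, −4B−2C−D) = 13·Q₁₃(A,B,C,D)` (`nrd(jx) = 13·nrd x`). [cite: Eichler1973, Ch. II §6 Thm. 2 (20)] -/
theorem form_thirteenMap (A B C D : ℤ) :
    (-A - 2 * B - 8 * C) ^ 2 + 2 * (-A + B + 4 * D) ^ 2 + 4 * (2 * A + C - D) ^ 2 + 2 * (-4 * B - 2 * C - D) ^ 2 +
        (-A - 2 * B - 8 * C) * (2 * A + C - D) - (-A - 2 * B - 8 * C) * (-4 * B - 2 * C - D) +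
        2 * (-A + B + 4 * D) * (2 * A + C - D) + (-A + B + 4 * D) * (-4 * B - 2 * C - D) =
      13 * (A ^ 2 + 2 * B ^ 2 + 4 * C ^ 2 + 2 * D ^ 2 + A * C - A * D + 2 * B * C + B * D) := by
  ring

/-- **`13 ∣ Q₁₃(a,b,c,d) ⟺ 2a + c − d ≡ 0 ∧ 4b + 2c + d ≡ 0 (mod 13)`** (`O₁₃/jO₁₃ ≅ 𝔽₁₆₉` is a field: the norm form vanishes
mod `13` exactly on the image of the `13`-map; `16Q₁₃ = 4(2a+c−d)² + 2(4b+2c+d)² + 52c² + 26d²`, `−2` a non-residue mod `13`).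
[cite: VignerasLNM800, Ch. II §1 Cor. 1.7] [cite: Voight2021, §13.3] -/
theorem thirteen_dvd_form_iff (a b c d : ℤ) :
    (13 : ℤ) ∣ a ^ 2 + 2 * b ^ 2 + 4 * c ^ 2 + 2 * d ^ 2 + a * c - a * d + 2 * b * c + b * d ↔
      (13 : ℤ) ∣ 2 * a + c - d ∧ (13 : ℤ) ∣ 4 * b + 2 * c + d := by
  have key : ∀ x y z w : ZMod 13, x ^ 2 + 2 * y ^ 2 + 4 * z ^ 2 + 2 * w ^ 2 + x * z - x * w + 2 * y * z + y * w = 0 ↔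
      2 * x + z - w = 0 ∧ 4 * y + 2 * z + w = 0 := by decide +kernel
  have e₁ := ZMod.intCast_zmod_eq_zero_iff_dvd (a ^ 2 + 2 * b ^ 2 + 4 * c ^ 2 + 2 * d ^ 2 + a * c - a * d + 2 * b * c + b * d) 13
  have e₂ := ZMod.intCast_zmod_eq_zero_iff_dvd (2 * a + c - d) 13
  have e₃ := ZMod.intCast_zmod_eq_zero_iff_dvd (4 * b + 2 * c + d) 13
  push_cast at e₁ e₂ e₃
  rw [← e₁, ← e₂, ← e₃]
  exact key _ _ _ _

/-- **`#{Q₁₃ = 13n} = #{Q₁₃ = n}`**: the `13`-map is a bijection from the solutions of `Q₁₃ = n` onto those of `Q₁₃ = 13n` (a solution of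
`Q₁₃ = 13n` satisfies the two congruences, and then `A = (a+2b+8c)/13`, `B = (a−b−4d)/13`, `C = (−2a−c+d)/13`, `D = (4b+2c+d)/13` is
its unique preimage). [cite: Eichler1973, Ch. II §2 and §6 Thm. 2 (20)] -/
theorem natCard_form_thirteen_mul (n : ℤ) :
    Nat.card {v : ℤ × ℤ × ℤ × ℤ //
        v.1 ^ 2 + 2 * v.2.1 ^ 2 + 4 * v.2.2.1 ^ 2 + 2 * v.2.2.2 ^ 2 + v.1 * v.2.2.1 - v.1 * v.2.2.2 +
          2 * v.2.1 * v.2.2.1 + v.2.1 * v.2.2.2 = 13 * n} =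
      Nat.card {v : ℤ × ℤ × ℤ × ℤ //
        v.1 ^ 2 + 2 * v.2.1 ^ 2 + 4 * v.2.2.1 ^ 2 + 2 * v.2.2.2 ^ 2 + v.1 * v.2.2.1 - v.1 * v.2.2.2 +
          2 * v.2.1 * v.2.2.1 + v.2.1 * v.2.2.2 = n} := by
  symm
  refine Nat.card_congr (Equiv.ofBijective
    (fun v => ⟨(-v.1.1 - 2 * v.1.2.1 - 8 * v.1.2.2.1, -v.1.1 + v.1.2.1 + 4 * v.1.2.2.2, 2 * v.1.1 + v.1.2.2.1 - v.1.2.2.2,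
        -4 * v.1.2.1 - 2 * v.1.2.2.1 - v.1.2.2.2), by
      have h := form_thirteenMap v.1.1 v.1.2.1 v.1.2.2.1 v.1.2.2.2
      rw [v.2] at h
      exact h⟩) ⟨?_, ?_⟩)
  · rintro ⟨⟨A, B, C, D⟩, hv⟩ ⟨⟨A', B', C', D'⟩, hv'⟩ h
    simp only [Subtype.mk.injEq, Prod.mk.injEq] at h
    obtain ⟨h1, h2, h3, h4⟩ := h
    have hA : A = A' := by omega
    have hB : B = B' := by omega
    have hC : C = C' := by omega
    have hD : D = D' := by omega
    subst hA hB hC hD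
    rfl
  · rintro ⟨⟨a, b, c, d⟩, h⟩
    have h5 : (13 : ℤ) ∣ a ^ 2 + 2 * b ^ 2 + 4 * c ^ 2 + 2 * d ^ 2 + a * c - a * d + 2 * b * c + b * d := ⟨n, h⟩
    obtain ⟨h₁, h₂⟩ := (thirteen_dvd_form_iff a b c d).1 h5
    obtain ⟨A, hA⟩ : (13 : ℤ) ∣ a + 2 * b + 8 * c := by omega
    obtain ⟨B, hB⟩ : (13 : ℤ) ∣ a - b - 4 * d := by omega
    obtain ⟨C, hC⟩ : (13 : ℤ) ∣ -2 * a - c + d := by omega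
    obtain ⟨D, hD⟩ : (13 : ℤ) ∣ 4 * b + 2 * c + d := by omega
    refine ⟨⟨⟨A, B, C, D⟩, ?_⟩, ?_⟩
    · have ha : a = -A - 2 * B - 8 * C := by omega
      have hb : b = -A + B + 4 * D := by omega
      have hc : c = 2 * A + C - D := by omega
      have hd : d = -4 * B - 2 * C - D := by omega
      have e := form_thirteenMap A B C D
      rw [← ha, ← hb, ← hc, ← hd, h] at e
      simpa using (mul_right_injective₀ (by norm_num : (13 : ℤ) ≠ 0) e).symm
    · simp only [Subtype.mk.injEq, Prod.mk.injEq]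
      omega

/-- **`#{Q₁₃ = 13ᵃn} = #{Q₁₃ = n}`** for every `a`. [cite: Eichler1973, Ch. II §6 Thm. 2 (20)] -/
theorem natCard_form_thirteen_pow_mul (a : ℕ) (n : ℤ) :
    Nat.card {v : ℤ × ℤ × ℤ × ℤ //
        v.1 ^ 2 + 2 * v.2.1 ^ 2 + 4 * v.2.2.1 ^ 2 + 2 * v.2.2.2 ^ 2 + v.1 * v.2.2.1 - v.1 * v.2.2.2 +
          2 * v.2.1 * v.2.2.1 + v.2.1 * v.2.2.2 = 13 ^ a * n} =
      Nat.card {v : ℤ × ℤ × ℤ × ℤ //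
        v.1 ^ 2 + 2 * v.2.1 ^ 2 + 4 * v.2.2.1 ^ 2 + 2 * v.2.2.2 ^ 2 + v.1 * v.2.2.1 - v.1 * v.2.2.2 +
          2 * v.2.1 * v.2.2.1 + v.2.1 * v.2.2.2 = n} := by
  induction a with
  | zero => rw [pow_zero, one_mul]
  | succ a ih => rw [pow_succ, mul_comm ((13 : ℤ) ^ a) 13, mul_assoc, natCard_form_thirteen_mul, ih]

/-- **`r₁₃(13ᵃ) = 2`**: the number of `(a,b,c,d) ∈ ℤ⁴` with `Q₁₃(a,b,c,d) = 13ᵃ` is `2` for every `a` (the two `±jᵃ`).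
[cite: Eichler1973, Ch. II §2 and §6 Thm. 2 (20)] [cite: Voight2021, Exercise 17.10] -/
theorem natCard_form_thirteen_pow (a : ℕ) :
    Nat.card {v : ℤ × ℤ × ℤ × ℤ //
        v.1 ^ 2 + 2 * v.2.1 ^ 2 + 4 * v.2.2.1 ^ 2 + 2 * v.2.2.2 ^ 2 + v.1 * v.2.2.1 - v.1 * v.2.2.2 +
          2 * v.2.1 * v.2.2.1 + v.2.1 * v.2.2.2 = (13 : ℤ) ^ a} = 2 := by
  have h := natCard_form_thirteen_pow_mul a 1
  rw [mul_one] at h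
  rw [h, natCard_form_eq_one]

end Form

/-! ## §2 For `O₁₃`: `#{nrd = 13n} = #{nrd = n}` -/

section Order

/-- **`#{x ∈ O₁₃ : nrd x = 13n} = #{x ∈ O₁₃ : nrd x = n}`** (`x ↦ jx`). [cite: Eichler1973, Ch. II §2 and §6 Thm. 2 (20)] [cite: VignerasLNM800, Ch. II §1 Lemme 1.5] -/
theorem natCard_reducedNorm_thirteen_mul (n : ℕ) :
    Nat.card {x : ℍ[ℚ,-2,-13] // x ∈ (Submodule.span ℤ (Set.range ![(⟨1, 0, 0, 0⟩ : ℍ[ℚ,-2,-13]), ⟨0, 1, 0, 0⟩, ⟨1/2, 1/2, 1/2, 0⟩, ⟨-1/2, 1/4, 0, 1/4⟩])) ∧ reducedNorm ℚ ℍ[ℚ,-2,-13] x = (13 * n : ℕ)} =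
      Nat.card {x : ℍ[ℚ,-2,-13] // x ∈ (Submodule.span ℤ (Set.range ![(⟨1, 0, 0, 0⟩ : ℍ[ℚ,-2,-13]), ⟨0, 1, 0, 0⟩, ⟨1/2, 1/2, 1/2, 0⟩, ⟨-1/2, 1/4, 0, 1/4⟩])) ∧ reducedNorm ℚ ℍ[ℚ,-2,-13] x = n} := by
  have h5 := natCard_reducedNorm_eq_natCard_form ((13 * n : ℕ) : ℤ)
  have hn := natCard_reducedNorm_eq_natCard_form (n : ℤ)
  push_cast at h5 hn ⊢
  rw [h5, hn]
  exact natCard_form_thirteen_mul n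

/-- **`#{x ∈ O₁₃ : nrd x = 13ᵃ} = 2`** for every `a`. [cite: Eichler1973, Ch. II §2] [cite: Voight2021, Exercise 17.10] -/
theorem natCard_reducedNorm_thirteen_pow (a : ℕ) :
    Nat.card {x : ℍ[ℚ,-2,-13] // x ∈ (Submodule.span ℤ (Set.range ![(⟨1, 0, 0, 0⟩ : ℍ[ℚ,-2,-13]), ⟨0, 1, 0, 0⟩, ⟨1/2, 1/2, 1/2, 0⟩, ⟨-1/2, 1/4, 0, 1/4⟩])) ∧ reducedNorm ℚ ℍ[ℚ,-2,-13] x = (13 ^ a : ℕ)} = 2 := by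
  have h := natCard_reducedNorm_eq_natCard_form ((13 ^ a : ℕ) : ℤ)
  push_cast at h ⊢
  rw [h]
  exact natCard_form_thirteen_pow a

/-- **For `x ∈ O₁₃` with `13 ∣ nrd x` there is `y ∈ O₁₃` with `x = jy`** (`𝔓 = jO₁₃` is the prime above `13`).
[cite: VignerasLNM800, Ch. II §1 Lemme 1.5] [cite: Voight2021, §13.3] -/
theorem exists_mem_eq_basisJ_mul_of_thirteen_dvd {x : ℍ[ℚ,-2,-13]} (hx : x ∈ (Submodule.span ℤ (Set.range ![(⟨1, 0, 0, 0⟩ : ℍ[ℚ,-2,-13]), ⟨0, 1, 0, 0⟩, ⟨1/2, 1/2, 1/2, 0⟩, ⟨-1/2, 1/4, 0, 1/4⟩]))) (h5 : ∃ m : ℤ, reducedNorm ℚ ℍ[ℚ,-2,-13] x = 13 * m) :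
    ∃ y ∈ (Submodule.span ℤ (Set.range ![(⟨1, 0, 0, 0⟩ : ℍ[ℚ,-2,-13]), ⟨0, 1, 0, 0⟩, ⟨1/2, 1/2, 1/2, 0⟩, ⟨-1/2, 1/4, 0, 1/4⟩])), x = ⟨0, 0, 1, 0⟩ * y := by
  obtain ⟨m, hm⟩ := h5
  obtain ⟨a, b, c, d, rfl⟩ := (mem_lattice_iff x).1 hx
  rw [reducedNorm_mk] at hm
  have h5 : (13 : ℤ) ∣ a ^ 2 + 2 * b ^ 2 + 4 * c ^ 2 + 2 * d ^ 2 + a * c - a * d + 2 * b * c + b * d := ⟨m, by exact_mod_cast hm⟩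
  obtain ⟨h₁, h₂⟩ := (thirteen_dvd_form_iff a b c d).1 h5
  obtain ⟨A, hA⟩ : (13 : ℤ) ∣ a + 2 * b + 8 * c := by omega
  obtain ⟨B, hB⟩ : (13 : ℤ) ∣ a - b - 4 * d := by omega
  obtain ⟨C, hC⟩ : (13 : ℤ) ∣ -2 * a - c + d := by omega
  obtain ⟨D, hD⟩ : (13 : ℤ) ∣ 4 * b + 2 * c + d := by omega
  refine ⟨_, mk_mem_lattice A B C D, ?_⟩
  rw [basisJ_mul_mk]
  have ha : a = -A - 2 * B - 8 * C := by omega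
  have hb : b = -A + B + 4 * D := by omega
  have hc : c = 2 * A + C - D := by omega
  have hd : d = -4 * B - 2 * C - D := by omega
  subst ha hb hc hd
  rfl

end Order

end Literature.NumberTheory.Automorphic.MaxOrderDiscThirteen
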